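import Summits.CriticalPhenomena.PercolationContinuityZ3.Theorems.PercNearOneGluingNoHeavyLowerTailSahiCombTriWSandwich

/-!
# SCORE CERTIFICATES for `TRI_W(a)`: sandwich certificates that are modular in the second family

Support file of the one-cut programme (crux `NoHeavyLowerTail`, stmt-CriticalPhenomena-4575; unit `prim-lf-1` gen 41, memo
`FROM-prim-lf-1-gen41-SCORE-CERTIFICATES.md`).  Continuation of `…SahiCombTriWSandwich` (P5 g24, the sandwich criterion).

A **score** is a function `c : Finset (Finset γ) → Finset γ → ℕ`, `(A, t) ↦ c A t`, MONOTONE in the family `A`; its value on a pair of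
families is `scoreVal c A B = Σ_{t ∈ B} c A t` (modular in `B`).  Every score value is a non-negative combination of products of monotone
one-family literals (`[θ ≤ c A t]·[t ∈ B]`), so the sandwich principle applies; we give the direct proof, which needs only the
WEIGHTED KLEITMAN LEMMA on the index cube: for a monotone `m : Finset β → ℕ` and an up-set `U` of the index cube,
`Σ_{x ∈ U} m xᶜ ≤ Σ_{x ∈ U} m x` (`FiveUpSet.sum_compl_le_sum_of_monotone`).

* `FiveUpSet.scoreVal`, `FiveUpSet.MonoScore`, `FiveUpSet.ScoreCert` — the value, monotonicity, and the certificate property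
  `L_P(A,B) ≤ Σ_{t∈B} c A t ≤ U_P(A,B)` for all up-sets `A, B`;
* **`FiveUpSet.triW_nonneg_of_scoreCert`** — a monotone score certificate for `P` gives `0 ≤ triW P F G` for EVERY index cube and all
  monotone families of up-sets (all `a`).
* The two LEDGERS (transport form).  For a fixed up-set `A` write `a_t = [t ∈ A]`, `ā_t = [tᶜ ∈ A]`.  Then (`scoreVal_sub_lForm`,
  `uForm_sub_scoreVal`) both sandwich slacks are sums over `t ∈ B` of point terms:
  `U_P(A,B) − Σ_B c = Σ_{t∈B} (2a_t[t∈P] − a_t[t∈refl P] − c A t)` and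
  `Σ_B c − L_P(A,B) = Σ_{t∈B} (c A t − ā_t[t∈P] − (ā_t − a_t)[t∈refl P])`,
  so a score certificate is exactly a monotone score whose two point functions have non-negative sums over every up-set `B`
  ("deficits are covered from above"); this is the form in which the strata files `…TriWScore*` verify their certificates.
Examples already in the tree in this language: the constant certificate `c A t = [t ∈ P ∩ A]` (`…TriWCorNonneg`), Formula A
`c A t = [t ∈ (P∖refl P) ∩ A] + [t ∈ P ∩ refl P][tᶜ ∈ A]` (`…TriWSaturated`), P5's `#(P ∩ B ∩ (A ∪ refl A))` for `K₂₂`.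
HONEST LABEL: a criterion (special case of the sandwich principle with a two-line proof obligation), complete proofs, std axioms;
not a proof of `TriWIneq`, which stays OPEN beyond the strata in the tree. [this work]
-/

namespace Summit.CriticalPhenomena.PercolationContinuityZ3.Theorems

namespace FiveUpSet

open Finset

variable {β γ : Type} [DecidableEq β] [Fintype β] [DecidableEq γ] [Fintype γ]

/-! ### The weighted Kleitman lemma on the index cube -/

omit [DecidableEq β] [Fintype β] [DecidableEq γ] [Fintype γ] in
/-- Threshold decomposition of a bounded natural-valued function: `m x = Σ_{θ < M} [θ < m x]` when `m x ≤ M`. [this work] -/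
theorem eq_sum_range_indicator {m : Finset β → ℕ} {M : ℕ} {x : Finset β} (hx : m x ≤ M) :
    (m x : ℤ) = ∑ θ ∈ range M, (if θ < m x then (1 : ℤ) else 0) := by
  rw [Finset.sum_boole]
  have h : (range M).filter (fun θ => θ < m x) = range (m x) := by
    ext θ
    simp only [mem_filter, mem_range]
    omega
  rw [h, card_range]

omit [DecidableEq β] [DecidableEq γ] [Fintype γ] in
/-- For a monotone `m : Finset β → ℕ` and a threshold `θ`, the super-level set `{x | θ < m x}` is an up-set of the index cube. [this work] -/
theorem isUpperSet_filter_lt {m : Finset β → ℕ} (hm : Monotone m) (θ : ℕ) :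
    IsUpperSet ((univ.filter fun x : Finset β => θ < m x : Finset (Finset β)) : Set (Finset β)) := by
  intro x y hxy hx
  simp only [coe_filter, mem_univ, true_and, Set.mem_setOf_eq] at hx ⊢
  exact lt_of_lt_of_le hx (hm hxy)

omit [DecidableEq γ] [Fintype γ] in
/-- **Weighted Kleitman lemma.**  For a monotone `m : Finset β → ℕ` and an up-set `U` of the index cube,
`Σ_{x ∈ U} m xᶜ ≤ Σ_{x ∈ U} m x`.  Proof: threshold decomposition and Kleitman's antipodal lemma `#(U ∩ refl X_θ) ≤ #(U ∩ X_θ)` for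
each super-level set `X_θ = {θ < m}`. [this work] -/
theorem sum_compl_le_sum_of_monotone {m : Finset β → ℕ} (hm : Monotone m) {U : Finset (Finset β)}
    (hU : IsUpperSet (U : Set (Finset β))) :
    ∑ x ∈ U, (m xᶜ : ℤ) ≤ ∑ x ∈ U, (m x : ℤ) := by
  -- a common bound `M` for all values of `m`
  set M : ℕ := m univ with hM
  have hle : ∀ x : Finset β, m x ≤ M := fun x => hm (subset_univ x)
  have h1 : ∑ x ∈ U, (m x : ℤ) = ∑ θ ∈ range M, (((univ.filter fun x : Finset β => θ < m x) ∩ U).card : ℤ) := by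
    calc ∑ x ∈ U, (m x : ℤ) = ∑ x ∈ U, ∑ θ ∈ range M, (if θ < m x then (1 : ℤ) else 0) :=
          sum_congr rfl fun x _ => eq_sum_range_indicator (hle x)
      _ = ∑ θ ∈ range M, ∑ x ∈ U, (if θ < m x then (1 : ℤ) else 0) := sum_comm
      _ = ∑ θ ∈ range M, (((univ.filter fun x : Finset β => θ < m x) ∩ U).card : ℤ) := by
          refine sum_congr rfl fun θ _ => ?_
          rw [Finset.sum_boole]
          congr 2
          ext x; simp only [mem_filter, mem_inter, mem_univ, true_and]; tauto
  have h2 : ∑ x ∈ U, (m xᶜ : ℤ) = ∑ θ ∈ range M, ((refl (univ.filter fun x : Finset β => θ < m x) ∩ U).card : ℤ) := by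
    calc ∑ x ∈ U, (m xᶜ : ℤ) = ∑ x ∈ U, ∑ θ ∈ range M, (if θ < m xᶜ then (1 : ℤ) else 0) :=
          sum_congr rfl fun x _ => eq_sum_range_indicator (hle xᶜ)
      _ = ∑ θ ∈ range M, ∑ x ∈ U, (if θ < m xᶜ then (1 : ℤ) else 0) := sum_comm
      _ = ∑ θ ∈ range M, ((refl (univ.filter fun x : Finset β => θ < m x) ∩ U).card : ℤ) := by
          refine sum_congr rfl fun θ _ => ?_
          rw [Finset.sum_boole]
          congr 2
          ext x; simp only [mem_filter, mem_inter, mem_univ, true_and, mem_refl]; tauto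
  rw [h1, h2]
  refine sum_le_sum fun θ _ => ?_
  exact_mod_cast card_refl_inter_le hU (isUpperSet_filter_lt hm θ)

/-! ### Scores and score certificates -/

/-- The value of a score `c` on a pair of families: `Σ_{t ∈ B} c A t` (modular in `B`). [this work] -/
def scoreVal (c : Finset (Finset γ) → Finset γ → ℕ) (A B : Finset (Finset γ)) : ℤ := ∑ t ∈ B, (c A t : ℤ)

/-- Monotonicity of a score in the family argument: `A ⊆ A' → c A t ≤ c A' t`. [this work] -/
def MonoScore (c : Finset (Finset γ) → Finset γ → ℕ) : Prop := ∀ A A' : Finset (Finset γ), A ⊆ A' → ∀ t : Finset γ, c A t ≤ c A' t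

/-- **Score certificate** for `P`: for all up-sets `A, B` of `W`, `L_P(A,B) ≤ Σ_{t∈B} c A t ≤ U_P(A,B)`. [this work] -/
def ScoreCert (P : Finset (Finset γ)) (c : Finset (Finset γ) → Finset γ → ℕ) : Prop :=
  ∀ A B : Finset (Finset γ), IsUpperSet (A : Set (Finset γ)) → IsUpperSet (B : Set (Finset γ)) →
    lForm P A B ≤ scoreVal c A B ∧ scoreVal c A B ≤ uForm P A B

omit [DecidableEq β] [Fintype γ] in
/-- The index profile of a point along a monotone family is an up-set of the index cube. [this work] -/
theorem isUpperSet_profile {G : Finset β → Finset (Finset γ)} (hGm : Monotone G) (t : Finset γ) :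
    IsUpperSet ((univ.filter fun x : Finset β => t ∈ G x : Finset (Finset β)) : Set (Finset β)) := by
  intro x y hxy hx
  simp only [coe_filter, mem_univ, true_and, Set.mem_setOf_eq] at hx ⊢
  exact hGm hxy hx

omit [DecidableEq β] in
/-- Exchange of summation: `Σ_x Σ_{t ∈ G x} f x t = Σ_t Σ_{x : t ∈ G x} f x t`. [this work] -/
theorem sum_sum_mem_comm (G : Finset β → Finset (Finset γ)) (f : Finset β → Finset γ → ℤ) :
    ∑ x : Finset β, ∑ t ∈ G x, f x t = ∑ t : Finset γ, ∑ x ∈ univ.filter (fun x : Finset β => t ∈ G x), f x t := by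
  have h1 : ∀ x : Finset β, ∑ t ∈ G x, f x t = ∑ t : Finset γ, if t ∈ G x then f x t else 0 := by
    intro x
    rw [← Finset.sum_filter, filter_univ_mem]
  have h2 : ∀ t : Finset γ, ∑ x ∈ univ.filter (fun x : Finset β => t ∈ G x), f x t = ∑ x : Finset β, if t ∈ G x then f x t else 0 := by
    intro t
    rw [← Finset.sum_filter]
  simp_rw [h1, h2]
  exact Finset.sum_comm

/-- **Score currency**: for a monotone score and monotone families, `0 ≤ Σ_x (Σ_{t∈G x} c (F x) t − Σ_{t∈G x} c (F xᶜ) t)` — exchange the sums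
and apply the weighted Kleitman lemma to `x ↦ c (F x) t` on the profile `{x | t ∈ G x}` of each point `t`. [this work] -/
theorem sum_scoreVal_sub_nonneg {c : Finset (Finset γ) → Finset γ → ℕ} (hc : MonoScore c)
    {F G : Finset β → Finset (Finset γ)} (hFm : Monotone F) (hGm : Monotone G) :
    0 ≤ ∑ x : Finset β, (scoreVal c (F x) (G x) - scoreVal c (F xᶜ) (G x)) := by
  unfold scoreVal
  rw [sum_sub_distrib, sum_sum_mem_comm G (fun x t => (c (F x) t : ℤ)), sum_sum_mem_comm G (fun x t => (c (F xᶜ) t : ℤ)),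
    ← sum_sub_distrib]
  refine sum_nonneg fun t _ => ?_
  have hmono : Monotone fun x : Finset β => c (F x) t := fun x y hxy => hc _ _ (hFm hxy) t
  have h := sum_compl_le_sum_of_monotone hmono (isUpperSet_profile hGm t)
  linarith

/-- **The score principle.**  A monotone score certificate for `P` gives `0 ≤ triW P F G` for EVERY index cube `Finset β` and all monotone
families `F, G` of up-sets of `W`: `triW = Σ_x (U_P(F x,G x) − L_P(F xᶜ,G x)) ≥ Σ_x (Σ_{G x} c (F x) − Σ_{G x} c (F xᶜ)) ≥ 0`. [this work] -/
theorem triW_nonneg_of_scoreCert {P : Finset (Finset γ)} {c : Finset (Finset γ) → Finset γ → ℕ}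
    (hc : MonoScore c) (hcert : ScoreCert P c)
    (F G : Finset β → Finset (Finset γ))
    (hF : ∀ x, IsUpperSet (F x : Set (Finset γ))) (hG : ∀ x, IsUpperSet (G x : Set (Finset γ)))
    (hFm : Monotone F) (hGm : Monotone G) :
    0 ≤ triW P F G := by
  have hmain : ∑ x : Finset β, (scoreVal c (F x) (G x) - scoreVal c (F xᶜ) (G x))
      ≤ ∑ x : Finset β, (uForm P (F x) (G x) - lForm P (F xᶜ) (G x)) := by
    refine sum_le_sum fun x _ => ?_
    have h1 := (hcert (F x) (G x) (hF x) (hG x)).2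
    have h2 := (hcert (F xᶜ) (G x) (hF xᶜ) (hG x)).1
    linarith
  rw [triW_eq_sum_uForm_sub_lForm]
  exact (sum_scoreVal_sub_nonneg hc hFm hGm).trans hmain

/-! ### The two ledgers -/

/-- Point indicator as an integer. [this work] -/
def ind (A : Finset (Finset γ)) (t : Finset γ) : ℤ := if t ∈ A then 1 else 0

omit [DecidableEq β] [Fintype β] [Fintype γ] in
/-- `#(X ∩ B) = Σ_{t∈B} [t ∈ X]`. [this work] -/
theorem card_inter_eq_sum_ind (X B : Finset (Finset γ)) : ((X ∩ B).card : ℤ) = ∑ t ∈ B, ind X t := by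
  unfold ind
  rw [Finset.sum_boole, inter_comm, ← filter_mem_eq_inter]

omit [DecidableEq β] [Fintype β] in
/-- **Upper ledger**: `U_P(A,B) − Σ_B c = Σ_{t∈B} (2[t∈P][t∈A] − [t∈refl P][t∈A] − c A t)`. [this work] -/
theorem uForm_sub_scoreVal (P : Finset (Finset γ)) (c : Finset (Finset γ) → Finset γ → ℕ) (A B : Finset (Finset γ)) :
    uForm P A B - scoreVal c A B
      = ∑ t ∈ B, (2 * ind P t * ind A t - ind (refl P) t * ind A t - (c A t : ℤ)) := by
  unfold uForm scoreVal
  have h1 : ((P ∩ A ∩ B).card : ℤ) = ∑ t ∈ B, ind P t * ind A t := by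
    rw [card_inter_eq_sum_ind]
    refine sum_congr rfl fun t _ => ?_
    unfold ind; by_cases hP : t ∈ P <;> by_cases hA : t ∈ A <;> simp [hP, hA, mem_inter]
  have h2 : ((refl P ∩ A ∩ B).card : ℤ) = ∑ t ∈ B, ind (refl P) t * ind A t := by
    rw [card_inter_eq_sum_ind]
    refine sum_congr rfl fun t _ => ?_
    unfold ind; by_cases hP : t ∈ refl P <;> by_cases hA : t ∈ A <;> simp [hP, hA, mem_inter]
  rw [h1, h2, mul_sum, ← sum_sub_distrib, ← sum_sub_distrib]
  refine sum_congr rfl fun t _ => ?_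
  ring

omit [DecidableEq β] [Fintype β] in
/-- **Lower ledger**: `Σ_B c − L_P(A,B) = Σ_{t∈B} (c A t − [t∈P][tᶜ∈A] − [t∈refl P]([tᶜ∈A] − [t∈A]))`
(uses `#(P ∩ A ∩ refl B) = #(refl P ∩ refl A ∩ B)`). [this work] -/
theorem scoreVal_sub_lForm (P : Finset (Finset γ)) (c : Finset (Finset γ) → Finset γ → ℕ) (A B : Finset (Finset γ)) :
    scoreVal c A B - lForm P A B
      = ∑ t ∈ B, ((c A t : ℤ) - ind P t * ind (refl A) t - ind (refl P) t * (ind (refl A) t - ind A t)) := by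
  unfold scoreVal lForm
  have hflip : ((P ∩ A ∩ refl B).card : ℤ) = ((refl P ∩ refl A ∩ B).card : ℤ) := by
    rw [← card_refl (P ∩ A ∩ refl B), refl_inter, refl_inter, refl_refl]
  have h1 : ((P ∩ refl A ∩ B).card : ℤ) = ∑ t ∈ B, ind P t * ind (refl A) t := by
    rw [card_inter_eq_sum_ind]
    refine sum_congr rfl fun t _ => ?_
    unfold ind; by_cases hP : t ∈ P <;> by_cases hA : t ∈ refl A <;> simp [hP, hA, mem_inter]
  have h2 : ((refl P ∩ refl A ∩ B).card : ℤ) = ∑ t ∈ B, ind (refl P) t * ind (refl A) t := by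
    rw [card_inter_eq_sum_ind]
    refine sum_congr rfl fun t _ => ?_
    unfold ind; by_cases hP : t ∈ refl P <;> by_cases hA : t ∈ refl A <;> simp [hP, hA, mem_inter]
  have h3 : ((refl P ∩ A ∩ B).card : ℤ) = ∑ t ∈ B, ind (refl P) t * ind A t := by
    rw [card_inter_eq_sum_ind]
    refine sum_congr rfl fun t _ => ?_
    unfold ind; by_cases hP : t ∈ refl P <;> by_cases hA : t ∈ A <;> simp [hP, hA, mem_inter]
  rw [hflip, h1, h2, h3, ← sum_add_distrib, ← sum_sub_distrib, ← sum_sub_distrib]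
  refine sum_congr rfl fun t _ => ?_
  ring

omit [DecidableEq β] [Fintype β] in
/-- **Ledger criterion.**  If for all up-sets `A, B` the two point functions of the ledgers have non-negative sums over `B`, the score is a
certificate. [this work] -/
theorem scoreCert_of_ledgers {P : Finset (Finset γ)} {c : Finset (Finset γ) → Finset γ → ℕ}
    (hup : ∀ A B : Finset (Finset γ), IsUpperSet (A : Set (Finset γ)) → IsUpperSet (B : Set (Finset γ)) →
      0 ≤ ∑ t ∈ B, (2 * ind P t * ind A t - ind (refl P) t * ind A t - (c A t : ℤ)))
    (hlow : ∀ A B : Finset (Finset γ), IsUpperSet (A : Set (Finset γ)) → IsUpperSet (B : Set (Finset γ)) →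
      0 ≤ ∑ t ∈ B, ((c A t : ℤ) - ind P t * ind (refl A) t - ind (refl P) t * (ind (refl A) t - ind A t))) :
    ScoreCert P c := by
  intro A B hA hB
  have h1 := uForm_sub_scoreVal P c A B
  have h2 := scoreVal_sub_lForm P c A B
  have h3 := hup A B hA hB
  have h4 := hlow A B hA hB
  constructor <;> linarith

end FiveUpSet

end Summit.CriticalPhenomena.PercolationContinuityZ3.Theorems
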